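/-
Copyright: lit-balaban Phase-2 proof seat p30 (gen 9).  Statement-level skeleton of a published paper; no proof claims beyond what
the kernel checks below.
-/
import Literature.MathematicalPhysics.QuantumFieldTheory.BalabanImbrieJaffe1984to88.BIJ85Prop12TorusBridgeSup

/-!
# [BalabanImbrieJaffe1985] (7.2.2) ⇐ [6I] Prop. 1.2 — TRANSFER of (1.111), first member, and the assembled `∀ i`-body (file 4 of 5)

T. Bałaban, J. Imbrie, A. Jaffe, Commun. Math. Phys. **97** (1985) 299–329 [BalabanImbrieJaffe1985], Sect. 7.2 p. 325; T. Bałaban,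
Commun. Math. Phys. **95** (1984) 17–40 [Balaban1984PropagatorsI] = [6I], Prop. 1.2 (1.109)–(1.111) p. 35 and (1.118) p. 36.

* §1 (1.111), first member `‖ζ∇GJ‖_α`, transferred to p09's carrier (`h1_transfer`): both the cut-off `ζ` (supported in the centred cube
  `Δ̃′(y)`) and the source `J` (in `Δ̃′(y_J)`) are split along r02's printed partition of unity (1.118); the unit-scale Lipschitz bound of
  the weights keeps `‖ζ_{y′}‖_α + |ζ_{y′}| ≤ (Lw(d)+1)(‖ζ‖_α + |ζ|)` UNIFORMLY IN `η = L^{−k}` (`cutHL_trZ_le`), the `36^d` cross terms are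
  bounded by r02's (1.111) (`h1_term_le`) and Hölder seminorms are subadditive; constant `36^d e^{4δ₀}(Lw(d)+1)max(C_α,0)`.
* §2 `ineq110_114_transfer`: the `∀ i`-body `B5.Ineq110_114` of [6I] Prop. 1.2 for r02's `latticeSettingP12R (L^k) (Mk P k) a K′`
  implies the body for p09's `settingOf (torusRep P k (deltaAData hk a)) kS`, constants `(6^d e^{3δ₀}C, 36^d e^{4δ₀}(Lw(d)+1)max(C_α,0),
  0, 0, δ₀)` — genuine clauses by `e0_transfer`, `e1_transfer` (`BIJ85Prop12TorusBridgeSup`), `h1_transfer`; the functionals that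
  `settingOf` sets to `0` trivially.
WHAT IS PROVED (0 `sorry`, theorems only, no `def`, no new named fact).  statement-level skeleton of published theorems with citation tags; proofs where landed; nothing here is a claim about the Yang–Mills mass gap.
Unit `lit-balaban-p30` (literature-prover-lit-balaban-p30-g9-0), 2026-08-21.
-/

open scoped BigOperators Matrix

namespace Literature.MathematicalPhysics.QuantumFieldTheory.BalabanImbrieJaffe1984to88.BIJ85Prop12TorusBridgeHolder

open Balaban1983to89 hiding Site Plaq
open Balaban1983to89.LatticeFieldCalculus (supDist)
open Balaban1983to89.B3TorusRadialSums (supDist_comm)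
open Balaban1983to89.B5Eq118OneStroke (iterBlockOf)
open Balaban1983to89.B5Eq117TorusCarriers (Mk EK)
open Balaban1983to89.B5Prop11Plancherel (Tor fine)
open Balaban1983to89.B5Prop12FieldsLattice (distU distSite cubeT cubeB suppInL supNormL holderT cutHL cutInL cutSupL smulT
  cutHL_nonneg supNormL_nonneg)
open Balaban1983to89.B5CoverP12Lattice (Lw Lw_nonneg)
open Balaban1983to89.B5DeltaA169 (DeltaA)
open Balaban1983to89.B5SettingP12Real (latticeSettingP12R LocR)
open Balaban1983to89.LatticeNorms (supNorm supNorm_le norm_le_supNorm supNorm_nonneg holderSeminorm holderSeminormB5 holder_bound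
  holderSeminorm_le holderSeminorm_nonneg)
open BIJ85Ineq722Proof BIJ85Ineq722ProofPart2 BIJ85Ineq722Torus BIJ85Ineq722DeltaA BIJ85Prop12TorusBridgeGeom BIJ85Prop12TorusBridgePieces
open BIJ85Prop12TorusBridgeSup
-- inside this namespace the bare `Site` is the `ℤ^d` carrier of the QFT root; the torus one is renamed:
open Balaban1983to89 renaming Site → TSite

noncomputable section

variable {P : Params} {k : ℕ}

section Transfer

variable (hk : k ≤ P.m + P.K) (a : ℝ)

/-! ## §1  (1.111), first member: `‖ζ∇G_kJ‖_α` -/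

/-- the defining bound of p09's Hölder seminorm of a cut-off: `|ζ(x) − ζ(x′)| ≤ ‖ζ‖_α|x − x′|^α` for `0 < |x − x′| ≤ 1`.
[cite: Balaban1984PropagatorsI, (1.109) p.35] -/
theorem abs_sub_le_holderS (R : Rep103) (α : ℝ) (ζ : R.S → ℝ) (x x' : R.S) (hpos : 0 < R.dS x x') (hle : R.dS x x' ≤ 1) :
    |ζ x - ζ x'| ≤ holderS R α ζ * R.dS x x' ^ α := by
  have hD : 0 < R.dS x x' ^ α := Real.rpow_pos_of_pos hpos α
  have h := norm_le_pi_norm (fun p : R.S × R.S =>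
    if 0 < R.dS p.1 p.2 ∧ R.dS p.1 p.2 ≤ 1 then |ζ p.1 - ζ p.2| / R.dS p.1 p.2 ^ α else 0) (x, x')
  simp only [if_pos (And.intro hpos hle), Real.norm_eq_abs, abs_div, abs_abs, abs_of_pos hD] at h
  rw [div_le_iff₀ hD] at h
  exact h

/-- `t ≤ t^α` for `0 < t ≤ 1`, `α < 1`. [cite: Balaban1984PropagatorsI, (1.109) p.35] -/
theorem le_rpow_of_le_one {t α : ℝ} (ht : 0 < t) (ht1 : t ≤ 1) (hα : α < 1) : t ≤ t ^ α := by
  have := Real.rpow_le_rpow_of_exponent_ge ht ht1 hα.le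
  rwa [Real.rpow_one] at this

/-- **THE CUT-OFF PIECES HAVE CONTROLLED HÖLDER SIZE, UNIFORMLY IN `η`**: `‖ζ_{y′}^‖_α + |ζ_{y′}^| ≤ (Lw(d) + 1)(‖ζ‖_α + |ζ|)`
(`‖·‖_α` on the left r02's `cutHL` over `T_η`, on the right p09's `holderS` over `T^{(0)}`, `0 ≤ α < 1`).
[cite: Balaban1984PropagatorsI, (1.109) p.35, (1.118) p.36] -/
theorem cutHL_trZ_le (D : TorusData P k) {α : ℝ} (hα1 : α < 1) (ζ : TSite P 0 → ℝ) (y' : TSite P k) :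
    cutHL (P.L ^ k) (Mk P k) α (trZ hk y' ζ) ≤ (Lw P.d + 1) * (holderS (torusRep P k D) α ζ + ‖ζ‖) := by
  have hH0 : 0 ≤ holderS (torusRep P k D) α ζ := norm_nonneg _
  have hL0 := Lw_nonneg P.d
  have hz0 : 0 ≤ ‖ζ‖ := norm_nonneg _
  -- the Hölder part
  have hH : holderSeminormB5 α (fun _ _ : Tor (fine (P.L ^ k) (Mk P k)) => True) (distU (P.L ^ k) (Mk P k)) Finset.univ
      (trZ hk y' ζ) ≤ holderS (torusRep P k D) α ζ + Lw P.d * ‖ζ‖ := by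
    unfold holderSeminormB5
    refine holderSeminorm_le (by positivity) fun z _ z' _ hadm hpos => ?_
    obtain ⟨x, rfl⟩ : ∃ x, EK hk x = z := ⟨(EK hk).symm z, Equiv.apply_symm_apply _ _⟩
    obtain ⟨x', rfl⟩ : ∃ x', EK hk x' = z' := ⟨(EK hk).symm z', Equiv.apply_symm_apply _ _⟩
    have hle1 : distU (P.L ^ k) (Mk P k) (EK hk x) (EK hk x') ≤ 1 := hadm.2
    rw [← dS_eq_distU hk D] at hpos hle1 ⊢
    simp only [trZ_apply, Equiv.symm_apply_apply, id, Real.norm_eq_abs]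
    have h1 := abs_pieceZ_sub_le hk y' ζ x' x
    rw [← dS_eq_distU hk D] at h1
    have hsym : (torusRep P k D).dS x' x = (torusRep P k D).dS x x' := by
      rw [torusRep_dS, torusRep_dS, supDist_comm]
    rw [hsym] at h1
    have h2 := abs_sub_le_holderS (torusRep P k D) α ζ x' x (by rwa [hsym]) (by rwa [hsym])
    rw [hsym] at h2
    have h3 : |ζ x| ≤ ‖ζ‖ := by rw [← Real.norm_eq_abs]; exact norm_le_pi_norm ζ x
    have h4 := le_rpow_of_le_one hpos hle1 hα1
    have hDa : 0 ≤ (torusRep P k D).dS x x' ^ α := (Real.rpow_pos_of_pos hpos α).le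
    calc |pieceZ hk y' ζ x' - pieceZ hk y' ζ x|
        ≤ |ζ x' - ζ x| + Lw P.d * (torusRep P k D).dS x x' * |ζ x| := h1
      _ ≤ holderS (torusRep P k D) α ζ * (torusRep P k D).dS x x' ^ α +
          Lw P.d * (torusRep P k D).dS x x' ^ α * ‖ζ‖ := by gcongr
      _ = (holderS (torusRep P k D) α ζ + Lw P.d * ‖ζ‖) * (torusRep P k D).dS x x' ^ α := by ring
  -- the sup part
  have hS : cutSupL (P.L ^ k) (Mk P k) (trZ hk y' ζ) ≤ ‖ζ‖ := by
    unfold cutSupL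
    refine supNorm_le hz0 fun z _ => ?_
    rw [trZ_apply, Real.norm_eq_abs]
    refine (abs_pieceZ_le hk y' ζ _).trans ?_
    rw [← Real.norm_eq_abs]; exact norm_le_pi_norm ζ _
  unfold cutHL
  nlinarith

/-- the defining bound of r02's tensor Hölder seminorm at one admissible pair (same `λ`, same component, `0 < |z − z′| ≤ 1`).
[cite: Balaban1984PropagatorsI, (1.109) p.35] -/
theorem norm_sub_le_holderT {d : ℕ} (n : ℕ) [NeZero n] (M : Fin d → ℕ) [∀ μ, NeZero (M μ)] (α : ℝ)
    (F : Fin d → (Tor (fine n M) × Fin d → ℂ)) (lam μ : Fin d) (z z' : Tor (fine n M)) (hpos : 0 < distU n M z z')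
    (hle : distU n M z z' ≤ 1) : ‖F lam (z', μ) - F lam (z, μ)‖ ≤ holderT n M α F * distU n M z z' ^ α := by
  unfold holderT holderSeminormB5
  exact holder_bound (adm := fun p p' : Fin d × (Tor (fine n M) × Fin d) => (p.1 = p'.1 ∧ p.2.2 = p'.2.2) ∧ distU n M p.2.1 p'.2.1 ≤ 1)
    (dist := fun p p' => distU n M p.2.1 p'.2.1) (τ := fun _ _ => id) (S := Finset.univ) (fun p => F p.1 p.2)
    (x := (lam, (z, μ))) (x' := (lam, (z', μ))) (Finset.mem_univ _) (Finset.mem_univ _) ⟨⟨rfl, rfl⟩, hle⟩ hpos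

/-- the cross term is the real part of a difference of values of r02's `ζ_{y′}^·∇_λ(Δ_a⁻¹J_{y″}^ℂ)`. [cite: Balaban1984PropagatorsI, (1.111) p.35] -/
theorem crossTerm_eq_re (J : TSite P 0 × Fin P.d → ℝ) (ζ : TSite P 0 → ℝ) (y' y'' : TSite P k) (z : TSite P 0) (lam μ : Fin P.d) :
    pieceZ hk y' ζ z * (DGk hk a *ᵥ pieceJ hk y'' J) (z, lam, μ) =
      (smulT (P.L ^ k) (Mk P k) (trZ hk y' ζ)
        (B5Prop11Lattice.grad (P.L ^ k) (Mk P k) ((DeltaA (P.L ^ k) (Mk P k) a)⁻¹ *ᵥ fun b => (trR hk (pieceJ hk y'' J) b : ℂ)))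
        lam (EK hk z, μ)).re := by
  rw [DGk_mulVec_re, trC_eq]
  simp only [smulT, trZ_apply, Equiv.symm_apply_apply, Complex.re_ofReal_mul]

/-- one cross term at one admissible pair: for `0 < |x − x′| ≤ 1`, `0 ≤ α < 1`,
`|ζ_{y′}(x)(∇G_kJ_{y″})_{λμ}(x) − ζ_{y′}(x′)(∇G_kJ_{y″})_{λμ}(x′)| ≤ max(C_α,0)e^{−δ₀|y′−y″|}(Lw+1)(‖ζ‖_α+|ζ|)|J|·|x − x′|^α` from r02's
(1.111) first member. [cite: Balaban1984PropagatorsI, (1.111) p.35] -/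
theorem h1_term_le {Cα : ℝ → ℝ} {δ₀ : ℝ}
    (hH : ∀ (α : ℝ) (Jr : Tor (fine (P.L ^ k) (Mk P k)) × Fin P.d → ℝ) (ζr : Tor (fine (P.L ^ k) (Mk P k)) → ℝ)
      (y y' : Tor (Mk P k)), 0 ≤ α → α < 1 → cutInL (P.L ^ k) (Mk P k) ζr y →
      suppInL (P.L ^ k) (Mk P k) (.vec fun b => (Jr b : ℂ)) y' →
      holderT (P.L ^ k) (Mk P k) α (smulT (P.L ^ k) (Mk P k) ζr
        (B5Prop11Lattice.grad (P.L ^ k) (Mk P k) ((DeltaA (P.L ^ k) (Mk P k) a)⁻¹ *ᵥ fun b => (Jr b : ℂ)))) ≤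
        Cα α * Real.exp (-(δ₀ * distSite (Mk P k) y y')) * cutHL (P.L ^ k) (Mk P k) α ζr *
          supNormL (P.L ^ k) (Mk P k) (.vec fun b => (Jr b : ℂ)))
    {α : ℝ} (hα0 : 0 ≤ α) (hα1 : α < 1) (J : TSite P 0 × Fin P.d → ℝ) (ζ : TSite P 0 → ℝ) (y' y'' : TSite P k)
    (x x' : TSite P 0) (lam μ : Fin P.d) (hpos : 0 < (torusRep P k (deltaAData hk a)).dS x x')
    (hle : (torusRep P k (deltaAData hk a)).dS x x' ≤ 1) :
    |pieceZ hk y' ζ x * (DGk hk a *ᵥ pieceJ hk y'' J) (x, lam, μ) -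
        pieceZ hk y' ζ x' * (DGk hk a *ᵥ pieceJ hk y'' J) (x', lam, μ)| ≤
      max (Cα α) 0 * Real.exp (-(δ₀ * supDist y' y'')) *
        ((Lw P.d + 1) * (holderS (torusRep P k (deltaAData hk a)) α ζ + ‖ζ‖)) * ‖J‖ *
        (torusRep P k (deltaAData hk a)).dS x x' ^ α := by
  rw [crossTerm_eq_re, crossTerm_eq_re, ← Complex.sub_re]
  refine (Complex.abs_re_le_norm _).trans ?_
  rw [norm_sub_rev]
  have hposU : 0 < distU (P.L ^ k) (Mk P k) (EK hk x) (EK hk x') := by rwa [← dS_eq_distU hk (deltaAData hk a)]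
  have hleU : distU (P.L ^ k) (Mk P k) (EK hk x) (EK hk x') ≤ 1 := by rwa [← dS_eq_distU hk (deltaAData hk a)]
  refine (norm_sub_le_holderT (P.L ^ k) (Mk P k) α _ lam μ (EK hk x) (EK hk x') hposU hleU).trans ?_
  rw [← dS_eq_distU hk (deltaAData hk a)]
  refine mul_le_mul_of_nonneg_right ?_ (Real.rpow_pos_of_pos hpos α).le
  -- r02's (1.111) for the pieces
  have h := hH α (trR hk (pieceJ hk y'' J)) (trZ hk y' ζ) y' y'' hα0 hα1 (cutInL_trZ hk y' ζ) (suppInL_pieceJ hk y'' J)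
  rw [distSite_eq_supDist] at h
  refine h.trans ?_
  have hcut := cutHL_trZ_le hk (deltaAData hk a) hα1 ζ y'
  have hJn : supNormL (P.L ^ k) (Mk P k) (.vec fun b => (trR hk (pieceJ hk y'' J) b : ℂ)) ≤ ‖J‖ :=
    (supNormL_trC_le hk _).trans (norm_pieceJ_le hk y'' J)
  have c0 := cutHL_nonneg (n := P.L ^ k) (M := Mk P k) α (trZ hk y' ζ)
  have s0 := supNormL_nonneg (n := P.L ^ k) (M := Mk P k) (.vec fun b => (trR hk (pieceJ hk y'' J) b : ℂ))
  have hH0 : 0 ≤ holderS (torusRep P k (deltaAData hk a)) α ζ := norm_nonneg _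
  have hL0 := Lw_nonneg P.d
  have e0 : 0 ≤ Real.exp (-(δ₀ * (supDist y' y'' : ℝ))) := Real.exp_nonneg _
  calc Cα α * Real.exp (-(δ₀ * (supDist y' y'' : ℝ))) * cutHL (P.L ^ k) (Mk P k) α (trZ hk y' ζ) *
          supNormL (P.L ^ k) (Mk P k) (.vec fun b => (trR hk (pieceJ hk y'' J) b : ℂ))
      ≤ max (Cα α) 0 * Real.exp (-(δ₀ * (supDist y' y'' : ℝ))) * cutHL (P.L ^ k) (Mk P k) α (trZ hk y' ζ) *
          supNormL (P.L ^ k) (Mk P k) (.vec fun b => (trR hk (pieceJ hk y'' J) b : ℂ)) := by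
        gcongr; exact le_max_left _ _
    _ ≤ max (Cα α) 0 * Real.exp (-(δ₀ * (supDist y' y'' : ℝ))) *
          ((Lw P.d + 1) * (holderS (torusRep P k (deltaAData hk a)) α ζ + ‖ζ‖)) * ‖J‖ := by
        gcongr

/-- **(1.111), FIRST MEMBER, ON p09's CARRIER**: for `0 ≤ α < 1`, `ζ` supported in `Δ̃′(y)`, `J` supported in `Δ̃′(y_J)`,
`‖ζ∇G_kJ‖_α ≤ 36^d e^{4δ₀}(Lw(d)+1)·max(C_α,0)·e^{−δ₀|y − y_J|_∞}(‖ζ‖_α + |ζ|)|J|`. [cite: Balaban1984PropagatorsI, (1.111) p.35] -/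
theorem h1_transfer {Cα : ℝ → ℝ} {δ₀ : ℝ} (hδ : 0 ≤ δ₀)
    (hH : ∀ (α : ℝ) (Jr : Tor (fine (P.L ^ k) (Mk P k)) × Fin P.d → ℝ) (ζr : Tor (fine (P.L ^ k) (Mk P k)) → ℝ)
      (y y' : Tor (Mk P k)), 0 ≤ α → α < 1 → cutInL (P.L ^ k) (Mk P k) ζr y →
      suppInL (P.L ^ k) (Mk P k) (.vec fun b => (Jr b : ℂ)) y' →
      holderT (P.L ^ k) (Mk P k) α (smulT (P.L ^ k) (Mk P k) ζr
        (B5Prop11Lattice.grad (P.L ^ k) (Mk P k) ((DeltaA (P.L ^ k) (Mk P k) a)⁻¹ *ᵥ fun b => (Jr b : ℂ)))) ≤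
        Cα α * Real.exp (-(δ₀ * distSite (Mk P k) y y')) * cutHL (P.L ^ k) (Mk P k) α ζr *
          supNormL (P.L ^ k) (Mk P k) (.vec fun b => (Jr b : ℂ)))
    {α : ℝ} (hα0 : 0 ≤ α) (hα1 : α < 1) (J : TSite P 0 × Fin P.d → ℝ) (ζ : TSite P 0 → ℝ) (y yJ : TSite P k)
    (hζ : ∀ x, ζ x ≠ 0 → x ∈ (torusRep P k (deltaAData hk a)).cube y)
    (hJ : ∀ i, J i ≠ 0 → i.1 ∈ (torusRep P k (deltaAData hk a)).cube yJ) :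
    holderG (torusRep P k (deltaAData hk a)) α (smulG (torusRep P k (deltaAData hk a)) ζ (DGk hk a *ᵥ J)) ≤
      (36 ^ P.d * Real.exp (4 * δ₀) * (Lw P.d + 1) * max (Cα α) 0) * Real.exp (-(δ₀ * (supDist y yJ : ℝ))) *
        (holderS (torusRep P k (deltaAData hk a)) α ζ + ‖ζ‖) * ‖J‖ := by
  classical
  set R := torusRep P k (deltaAData hk a) with hR
  have hH0 : 0 ≤ holderS R α ζ := norm_nonneg _
  have hL0 := Lw_nonneg P.d
  -- the bound for one admissible pair
  have hpair : ∀ (x x' : TSite P 0) (lam μ : Fin P.d), 0 < R.dS x x' → R.dS x x' ≤ 1 →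
      |ζ x * (DGk hk a *ᵥ J) (x, lam, μ) - ζ x' * (DGk hk a *ᵥ J) (x', lam, μ)| ≤
        (2 * 2 + 2) ^ P.d * ((2 * 2 + 2) ^ P.d * (max (Cα α) 0 * (Real.exp (4 * δ₀) * Real.exp (-(δ₀ * (supDist y yJ : ℝ)))) *
          ((Lw P.d + 1) * (holderS R α ζ + ‖ζ‖)) * ‖J‖ * R.dS x x' ^ α)) := by
    intro x x' lam μ hpos hle
    set B := max (Cα α) 0 * (Real.exp (4 * δ₀) * Real.exp (-(δ₀ * (supDist y yJ : ℝ)))) *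
      ((Lw P.d + 1) * (holderS R α ζ + ‖ζ‖)) * ‖J‖ * R.dS x x' ^ α with hB
    have hDa : 0 ≤ R.dS x x' ^ α := (Real.rpow_pos_of_pos hpos α).le
    have hB0 : 0 ≤ B := by positivity
    -- expand both factors along the partition of unity
    have hsplit : ∀ z : TSite P 0, ζ z * (DGk hk a *ᵥ J) (z, lam, μ) =
        ∑ y' : TSite P k, ∑ y'' : TSite P k, pieceZ hk y' ζ z * (DGk hk a *ᵥ pieceJ hk y'' J) (z, lam, μ) := by
      intro z
      have hz : ζ z = ∑ y' : TSite P k, pieceZ hk y' ζ z := by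
        conv_lhs => rw [← sum_pieceZ hk ζ]
        rw [Finset.sum_apply]
      have hJz : (DGk hk a *ᵥ J) (z, lam, μ) = ∑ y'' : TSite P k, (DGk hk a *ᵥ pieceJ hk y'' J) (z, lam, μ) := by
        conv_lhs => rw [← sum_pieceJ hk J]
        rw [mulVec_finset_sum, Finset.sum_apply]
      rw [hz, hJz, Finset.sum_mul_sum]
    rw [hsplit, hsplit, ← Finset.sum_sub_distrib]
    simp_rw [← Finset.sum_sub_distrib]
    refine abs_sum_ball_le _ y 2 (by positivity) (fun y' hfar => ?_) (fun y' hy' => ?_)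
    · simp only [pieceZ_eq_zero_of_far hk hζ hfar, Pi.zero_apply, zero_mul, sub_self, Finset.sum_const_zero]
    · refine abs_sum_ball_le _ yJ 2 hB0 (fun y'' hfar => ?_) (fun y'' hy'' => ?_)
      · simp only [pieceJ_eq_zero_of_far hk hJ hfar, Matrix.mulVec_zero, Pi.zero_apply, mul_zero, sub_self]
      · refine (h1_term_le hk a hH hα0 hα1 J ζ y' y'' x x' lam μ hpos hle).trans ?_
        rw [hB]
        have hexp : Real.exp (-(δ₀ * (supDist y' y'' : ℝ))) ≤ Real.exp (4 * δ₀) * Real.exp (-(δ₀ * (supDist y yJ : ℝ))) := by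
          apply exp_le_of_triangle hδ
          have t1 := supDist_triangle y y' yJ
          have t2 := supDist_triangle y' y'' yJ
          rw [supDist_comm y y'] at t1
          have : (supDist y yJ : ℝ) ≤ (2 : ℕ) + (supDist y' y'' : ℝ) + (2 : ℕ) := by
            exact_mod_cast (by omega : supDist y yJ ≤ 2 + supDist y' y'' + 2)
          push_cast at this; linarith
        gcongr
  -- the Hölder seminorm is a sup over admissible pairs
  unfold holderG
  rw [pi_norm_le_iff_of_nonneg (by positivity)]
  intro p
  split_ifs with hp
  · obtain ⟨hdir, hpos, hle⟩ := hp
    have hDa : 0 < R.dS p.1.1 p.2.1 ^ α := Real.rpow_pos_of_pos hpos α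
    rw [Real.norm_eq_abs, abs_div, abs_abs, abs_of_pos hDa, div_le_iff₀ hDa]
    obtain ⟨⟨x, lam, μ⟩, ⟨x', lam', μ'⟩⟩ := p
    simp only at hdir hpos hle ⊢
    obtain ⟨rfl, rfl⟩ := Prod.mk.inj hdir
    refine (hpair x x' lam μ hpos hle).trans (le_of_eq ?_)
    rw [show (36 : ℝ) ^ P.d = 6 ^ P.d * 6 ^ P.d by rw [← mul_pow]; norm_num]
    norm_num; ring
  · rw [norm_zero]; positivity

/-! ## §2  Assembly: the `∀ i`-body of [6I] Prop. 1.2 transferred between the two carriers -/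

/-- **THE TRANSFER**: the `∀ i`-body `B5.Ineq110_114` of [6I] Prop. 1.2 for r02's real setting of record
`latticeSettingP12R (L^k) (Mk P k) a K′` (any level label `K′`) implies the same body for p09's carrier
`settingOf (torusRep P k (deltaAData hk a)) kS` (any level label `kS`), with constants `C′ = 6^d e^{3δ₀}C`, `C′_α = 36^d e^{4δ₀}(Lw(d)+1)max(C_α,0)`,
`C′_ε = C′_{αε} = 0` and the same rate `δ₀` (`C ≥ 0`, `δ₀ ≥ 0`) — the genuine clauses by `e0_transfer`, `e1_transfer`, `h1_transfer`, the
void ones (functionals set to `0` in `settingOf`) trivially. [cite: Balaban1984PropagatorsI, Prop. 1.2 (1.110)–(1.114) pp.35–36] -/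
theorem ineq110_114_transfer {C δ₀ : ℝ} {Cα Cε : ℝ → ℝ} {Cαε : ℝ → ℝ → ℝ} (hC : 0 ≤ C) (hδ : 0 ≤ δ₀) (K' kS : ℕ)
    (hr : B5.Ineq110_114 (latticeSettingP12R (P.L ^ k) (Mk P k) a K') C Cα Cε Cαε δ₀) :
    B5.Ineq110_114 (settingOf (torusRep P k (deltaAData hk a)) kS) (6 ^ P.d * Real.exp (3 * δ₀) * C)
      (fun α => 36 ^ P.d * Real.exp (4 * δ₀) * (Lw P.d + 1) * max (Cα α) 0) (fun _ => 0) (fun _ _ => 0) δ₀ := by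
  obtain ⟨hr1, hr2, -, -, -⟩ := hr
  have h0 : ∀ (Jr : Tor (fine (P.L ^ k) (Mk P k)) × Fin P.d → ℝ) (y y' : Tor (Mk P k)),
      suppInL (P.L ^ k) (Mk P k) (.vec fun b => (Jr b : ℂ)) y' →
      supNorm (cubeB (P.L ^ k) (Mk P k) y) ((DeltaA (P.L ^ k) (Mk P k) a)⁻¹ *ᵥ fun b => (Jr b : ℂ)) ≤
        C * Real.exp (-(δ₀ * distSite (Mk P k) y y')) * supNormL (P.L ^ k) (Mk P k) (.vec fun b => (Jr b : ℂ)) :=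
    fun Jr y y' hs => hr1 0 (LocR.vec Jr) y y' hs
  have h1 : ∀ (Jr : Tor (fine (P.L ^ k) (Mk P k)) × Fin P.d → ℝ) (y y' : Tor (Mk P k)),
      suppInL (P.L ^ k) (Mk P k) (.vec fun b => (Jr b : ℂ)) y' →
      supNorm (Finset.univ ×ˢ cubeB (P.L ^ k) (Mk P k) y)
        (fun p : Fin P.d × (Tor (fine (P.L ^ k) (Mk P k)) × Fin P.d) =>
          B5Prop11Lattice.grad (P.L ^ k) (Mk P k) ((DeltaA (P.L ^ k) (Mk P k) a)⁻¹ *ᵥ fun b => (Jr b : ℂ)) p.1 p.2) ≤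
        C * Real.exp (-(δ₀ * distSite (Mk P k) y y')) * supNormL (P.L ^ k) (Mk P k) (.vec fun b => (Jr b : ℂ)) :=
    fun Jr y y' hs => hr1 1 (LocR.vec Jr) y y' hs
  have hH : ∀ (α : ℝ) (Jr : Tor (fine (P.L ^ k) (Mk P k)) × Fin P.d → ℝ) (ζr : Tor (fine (P.L ^ k) (Mk P k)) → ℝ)
      (y y' : Tor (Mk P k)), 0 ≤ α → α < 1 → cutInL (P.L ^ k) (Mk P k) ζr y →
      suppInL (P.L ^ k) (Mk P k) (.vec fun b => (Jr b : ℂ)) y' →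
      holderT (P.L ^ k) (Mk P k) α (smulT (P.L ^ k) (Mk P k) ζr
        (B5Prop11Lattice.grad (P.L ^ k) (Mk P k) ((DeltaA (P.L ^ k) (Mk P k) a)⁻¹ *ᵥ fun b => (Jr b : ℂ)))) ≤
        Cα α * Real.exp (-(δ₀ * distSite (Mk P k) y y')) * cutHL (P.L ^ k) (Mk P k) α ζr *
          supNormL (P.L ^ k) (Mk P k) (.vec fun b => (Jr b : ℂ)) :=
    fun α Jr ζr y y' hα0 hα1 hζ hs => hr2 α (LocR.vec Jr) ζr y y' hα0 hα1 hζ hs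
  refine ⟨?_, ?_, ?_, ?_, ?_⟩
  · intro n J y y' hJ
    dsimp only [settingOf]
    dsimp only [settingOf] at J y y' hJ
    split_ifs with hn0 hn1
    · exact e0_transfer hk a hC hδ h0 J y y' hJ
    · exact e1_transfer hk a hC hδ h1 J y y' hJ
    · positivity
  · intro α J ζ y y' hα0 hα1 hζ hJ
    exact h1_transfer hk a hδ hH hα0 hα1 J ζ y y' hζ hJ
  · intro ε J y y' _ _ _
    show (0 : ℝ) ≤ 0 * _ * _
    simp
  · intro α ε J ζ y y' _ _ _ _ _
    show (0 : ℝ) ≤ 0 * _ * _ * _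
    simp
  · intro n J ζ y y' _ _
    show (0 : ℝ) ≤ _ * _ * _ * 0
    simp

end Transfer

end

end Literature.MathematicalPhysics.QuantumFieldTheory.BalabanImbrieJaffe1984to88.BIJ85Prop12TorusBridgeHolder
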